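import Mathlib

/-!
# Sketch — first lemmas of the two crux ideas for `SeparableGalois.GaloisQuotientModels`
(crux stmt-ResolutionOfSingularities-18955; crux-ideate round 1, ideator 1).

* `FerociousEnlargement.stub_ferocify` — card `ferocious-enlargement`: the Artin–Schreier SHADOW
  `T^p − u^{p−1} T = u` of the forbidden `p`-th root of a boundary equation `u`, followed by the
  ferocious normal form `W^p − T^{m(p−1)} W = y·η^m` of an Artin–Schreier layer `z^p − z = y/u^m`
  (`η = 1 + u^{p−2} T`, `w = z T^m`), is a REGULAR ring: the enlargement regularises the layer
  with no blow-up wherever the residual datum `y` is a regular parameter transversal to `u`.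
* `InseparabilityFoliation.stub_sandwich` — card `inseparability-foliation-sandwich`: the
  Frobenius sandwich `L₂ = K₂ · L^p` of a `G`-Galois extension `L / L^G` over a subfield
  `K₂ ⊆ L^G` with `(L^G)^p ⊆ K₂` is `G`-stable and meets `L^G` exactly in `K₂`
  (so `L₂^G = K₂`: Galois over `K₂` with the same group — de Jong's purely inseparable defect
  `K₂ ⊊ L^G` is removed at the level of FIELDS for free; the geometry moves to the quotient of the
  regular top by the inseparability foliation `Der(L/L₂)`).
Both are `sorry`-stubs: they must elaborate, not be proved here.
-/

namespace Summit.ResolutionOfSingularities.ResolutionOfSingularities.Cruxes.GaloisQuotientModels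

open Polynomial IsLocalRing

namespace FerociousEnlargement

/-- FIRST LEMMA of card `ferocious-enlargement` (ferocification of one Artin–Schreier layer).
`A` regular local of characteristic `p`, `u, y` part of a regular system of parameters
(rendered: `A ⧸ (u, y)` regular of dimension `dim A − 2`), `m ≥ 1` (any residue of `m` mod `p`).
`A₁ = A[T]/(T^p − u^{p−1}T − u)` is the AS-shadow of `u^{1/p}` (Galois `ℤ/p`: roots `T + a·u`,
`a ∈ 𝔽_p`; étale off `u = 0`; `u = T^p · η⁻¹`, `η = 1 + u^{p−2}T` a unit), and
`A₂ = A₁[W]/(W^p − T^{m(p−1)} W − y η^m)` is the normal form of the pulled-back layer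
`z^p − z = y/u^m` (`W = z T^m`). Claim: `A₂` is a regular ring (hence the integral closure of `A`
in the compositum, a `(ℤ/p)²`-extension étale off `u = 0`). -/
theorem stub_ferocify (p : ℕ) [Fact p.Prime] (A : Type) [CommRing A] [IsRegularLocalRing A]
    [CharP A p] (u y : A) (hu : u ∈ maximalIdeal A) (hy : y ∈ maximalIdeal A)
    (hpar : IsRegularLocalRing (A ⧸ Ideal.span ({u, y} : Set A)))
    (hdim : ringKrullDim (A ⧸ Ideal.span ({u, y} : Set A)) + 2 = ringKrullDim A)
    (m : ℕ) (hm : 0 < m) :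
    let g : A[X] := X ^ p - C (u ^ (p - 1)) * X - C u
    let A₁ := AdjoinRoot g
    let t : A₁ := AdjoinRoot.root g
    let η : A₁ := 1 + algebraMap A A₁ (u ^ (p - 2)) * t
    let h : A₁[X] := X ^ p - C (t ^ (m * (p - 1))) * X - C (algebraMap A A₁ y * η ^ m)
    IsRegularRing (AdjoinRoot h) := by
  sorry

/-- The shadow identity behind `stub_ferocify`: in `A₁`, `u · η = T^p` (so `u` is a `p`-th power
up to the unit `η`). Pure ring arithmetic from `T^p = u^{p−1} T + u`. -/
theorem shadow_identity (p : ℕ) [Fact p.Prime] (A : Type) [CommRing A] (u : A) (hp : 2 ≤ p) :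
    let g : A[X] := X ^ p - C (u ^ (p - 1)) * X - C u
    algebraMap A (AdjoinRoot g) u * (1 + algebraMap A (AdjoinRoot g) (u ^ (p - 2)) * AdjoinRoot.root g)
      = AdjoinRoot.root g ^ p := by
  intro g
  have h0 : AdjoinRoot.mk g (X ^ p - C (u ^ (p - 1)) * X - C u) = 0 := AdjoinRoot.mk_self
  simp only [map_sub, map_mul, map_pow, AdjoinRoot.mk_X, AdjoinRoot.mk_C] at h0
  rw [AdjoinRoot.algebraMap_eq, map_pow]
  have hx : (AdjoinRoot.of g) u ^ (p - 1) = (AdjoinRoot.of g) u ^ (p - 2) * (AdjoinRoot.of g) u := by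
    rw [← pow_succ]; congr 1; omega
  linear_combination -h0 - AdjoinRoot.root g * hx

end FerociousEnlargement

namespace InseparabilityFoliation

/-- FIRST LEMMA of card `inseparability-foliation-sandwich` (the Frobenius sandwich, pure field
theory). `G` a finite group of automorphisms of a field `L` of characteristic `p`, `K₁ = L^G`,
`K₂ ⊆ K₁` a subfield with `K₁^p ⊆ K₂` (e.g. `K₂ = K(X)·K₁^p` for de Jong's purely inseparable
defect `K(X) ⊆ K₁`). Put `L₂ := K₂ ⊔ L^p`. Then `L₂` is `G`-stable and `L₂ ∩ K₁ = K₂` — hence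
`L₂^G = K₂` and `L₂ / K₂` is Galois with group `G`; moreover `[L : L₂] = [K₁ : K₂]` (not rendered).
Proof sketch: `L^p / K₁^p` is separable, `K₁ / K₁^p` purely inseparable, so they are linearly
disjoint over `K₁^p` (Mathlib `IntermediateField.linearDisjoint_of_isPurelyInseparable_of_isSeparable`)
and `L = L^p · K₁`; intermediate fields of `K₁ / K₁^p` correspond to `L^p · (–)`. -/
theorem stub_sandwich (p : ℕ) [Fact p.Prime] (L : Type) [Field L] [CharP L p]
    (G : Type) [Group G] [Finite G] [MulSemiringAction G L] [FaithfulSMul G L]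
    (K₂ : Subfield L) (hK₂ : K₂ ≤ FixedPoints.subfield G L)
    (hpow : ∀ a ∈ FixedPoints.subfield G L, a ^ p ∈ K₂) :
    let L₂ : Subfield L := K₂ ⊔ (frobenius L p).fieldRange
    (∀ g : G, ∀ a ∈ L₂, g • a ∈ L₂) ∧ L₂ ⊓ FixedPoints.subfield G L = K₂ := by
  sorry

/-- Typed shape of the TRANSFER target of card `inseparability-foliation-sandwich` at the level
of function fields and one local ring (mirrors `FoliationDescent.FolLU`'s rendering of a
`p`-closed derivation): a `p`-closed `k`-derivation `D` of `K` mapping a local ring `S ⊆ K` into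
itself is LOG-CANONICAL at `S` if it is non-singular there (some value is a unit) or
multiplicative (`D^p = c • D` with `c` a unit of `S`). The card's conjecture `EqFolRed` asks for
this at every local ring of a `G`-equivariant regular modification of de Jong's top, for
`D` a generator of the inseparability line field `Der(L/L₂)`. -/
def IsLogCanonicalAt (p : ℕ) (k K : Type) [Field k] [Field K] [Algebra k K]
    (D : Derivation k K K) (S : Subalgebra k K) : Prop :=
  (∀ s ∈ S, D s ∈ S) ∧
    ((∃ s ∈ S, ∃ v ∈ S, D s * v = 1) ∨
      ∃ c : K, (c ∈ S ∧ ∃ v ∈ S, c * v = 1) ∧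
        ∀ x : K, ((D : K →ₗ[k] K) ^ p) x = c • D x)

end InseparabilityFoliation

end Summit.ResolutionOfSingularities.ResolutionOfSingularities.Cruxes.GaloisQuotientModels
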